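import Summits.HodgeConjecture.HodgeConjecture.Theorems.Ring2AbelianAllAndreCrossCorrespondence
import Summits.HodgeConjecture.CorCM.Model.PolarContraction
import Summits.HodgeConjecture.CorCM.Model.FourierOpInjective
import Summits.HodgeConjecture.CorCM.Model.FourierSum
import Summits.HodgeConjecture.CorCM.Model.LefschetzPowToCupPow
import Summits.HodgeConjecture.CorCM.Model.PolarizationDatum
import Summits.HodgeConjecture.CorCM.CycleClassFacts
import Literature.AlgebraicGeometry.HodgeTheory.ComplexGysinCorrespondence
import Literature.AlgebraicGeometry.HodgeTheory.CrossProductTopClass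
import Literature.AlgebraicGeometry.HodgeTheory.SupportedClassesRationalProofs
import HarnessLib

/-!
# Ring 2 · sub-cell AbelianAll, André axis, part XXII-a — TOWARDS LIEBERMAN'S `B(A)` ON THE REAL CARRIERS:
# the Fourier correspondence of a polarised complex abelian variety is ALGEBRAIC and BIJECTIVE
# `H^j(A(ℂ); ℂ) → H^i(A(ℂ); ℂ)`, `j + i = 2 dim A`

HONEST FRAMING (page 1, verbatim): **research route, not a corollary; conditional on HC_CM plus one named
minimal statement.** Cell line: research route conditional on HC_CM; not a corollary; Q11.4-sentence-2
already refuted in dim ≥ 3. Nothing in this file proves a case of the Hodge conjecture; `HC_CM` does not occur.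
Seat `pub-hodge-ring2-ab-andre-2`, gen 14; brief (iii) "B for abelian varieties themselves is KNOWN —
Lieberman/Kleiman": the named fact `Lieberman1968_lefschetzInvolution_algebraic_abelianVariety` (`hL`) is a
load-bearing BINDER of the André axis (parts XVIII-e, XXI-c; ab-andre-1 part XIV; `LefschetzPencils`); parts
XXII-a/b/c DISCHARGE it on the real carriers. This part supplies the one geometric input of Kleiman's proof
(Dix exposés, App. 2A, 2A8–2A11; Lieberman, Amer. J. Math. 90 (1968)): for a complex abelian variety `A` of
dimension `g ≥ 1` with a polarisation class `η` and `j + i = 2g`, an ALGEBRAIC class `γ ∈ Nⁱ H^{2i}((A × A)(ℂ); ℂ)`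
whose correspondence action `γ_* = pr_{1*}(pr_2^*(·) ∪ γ) : H^j(A(ℂ); ℂ) → H^i(A(ℂ); ℂ)` is BIJECTIVE.

## The argument

The heavy lifting is the COR-CM cell's row M22 (`Summits/HodgeConjecture/CorCM/Model/`), on the RATIONAL Betti
carriers: for a basis `b` of `H¹(A(ℂ); ℚ)` and the polar family `y` of `θ` (`η = θ ⊗ 1`) along `b` — a basis as
soon as `θ^g ≠ 0` (`polarFamily_linearIndependent`, `polarFamily_span_eq_top`) — the Fourier kernel
`Σ_{c : Fin i → Fin N} pr₁^* m_i(b ∘ c) ∪ pr₂^* m_i(y ∘ c) = ± ℓ(θ)^i` (`ℓ(θ) = m^*θ − pr₁^*θ − pr₂^*θ` the Poincaré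
class) is a rational algebraic class (`sum_pull_cupPowOne_cup_mem_ratAlgebraicClasses`), and the Fourier sum
`z ↦ Σ_c tr(z ∪ m_i(b ∘ c)) • m_i(y ∘ c)` is bijective `H^j(A(ℂ); ℚ) → Hⁱ(A(ℂ); ℚ)` (`bijective_of_eq_fourierSum_tr`).
This file transports that to the André-axis vocabulary (`corrAction complexOrientationFamily`,
`IsAlgebraicCorrespondence`, `complexBetti`):
* §1 the action of a cross product `pr₁^* x ∪ pr₂^* y` of ANY parity: `c ↦ (−1)^{a·i} τ(c ∪ y) • x`, with ONE
  functional `τ` on `H^{2n}(X(ℂ); ℂ)` detecting non-zero top classes (part XIV-a's even-degree computation, signed);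
* §2 `τ ∘ (· ⊗ 1) = κ · tr` on the rational top line (`κ ≠ 0`);
* §3 swapping the two factors of a sum of cross products keeps it algebraic (pull back along the braiding);
* §4 `θ^g ≠ 0` for a polarisation class `η = θ ⊗ 1` (hard Lefschetz `L^g : H⁰ ⥲ H^{2g}`);
* §5 **`exists_bijective_corrAction`**: the complexified SWAPPED kernel `γ` is algebraic, `γ_* (z ⊗ 1) = ± κ · (F z) ⊗ 1`
  with `F` the rational Fourier sum, so `γ_*` is surjective (rational classes span) hence bijective (equal Betti
  numbers `(2g choose j) = (2g choose i)`); **`exists_bijective_algebraicCorrespondence`** (`IsAlgebraicCorrespondence` form).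

## What is proved (theorems only; no definition, no named fact, no sorry)

EDGE LABELS: all K (kernel). References: Kleiman1968AlgebraicCycles (App. to §2, 2A8–2A11); Lieberman1968
(pp. 366–374); MumfordAV1970 (§1 (4), §16, §20); VoisinHodgeII2003 (proof of Thm. 10.17 (10.7), Prop. 9.20);
FultonYoungTableaux1997 (App. B §B.1 (3), (5), (6)); HatcherAT2002 (§3.2 Prop. 3.10, Thm. 3.11, Thm. 3.15, §3.3 Thm. 3.26).
-/

noncomputable section

set_option linter.dupNamespace false

namespace Summit.HodgeConjecture.HodgeConjecture.Ring2.AbelianAll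

open CategoryTheory AlgebraicGeometry MonoidalCategory CartesianMonoidalCategory
open Literature.AlgebraicGeometry Literature.AlgebraicGeometry.Motives
open Literature.AlgebraicGeometry.HodgeTheory
open Literature.AlgebraicTopology.SingularHomology (singularCohomology cupProduct cupProduct_one'
  cupProduct_assoc cupProduct_gradedComm_holds singularCohomologyZeroEquiv cupPowOne)
open Literature.AlgebraicTopology.CharacteristicClasses (cupPow)
open Literature.NumberTheory.Automorphic.PicardCM (ratAlgebraicClasses mem_ratAlgebraicClasses_iff)
open Summit.HodgeConjecture.CorCM.Model

variable {m n : ℕ} {W X : SchemeOver ℂ}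

/-! ## §1 The action of a cross product `pr_W^* x ∪ pr_X^* y` of any parity -/

/-- **Voisin II (10.7) for a cross product, signed form.** For `W`, `X` smooth projective of dimensions `m`, `n`,
`x ∈ Hⁱ(W(ℂ))`, `y ∈ Hᵏ(X(ℂ))`, `c ∈ Hᵃ(X(ℂ))`, `a + k = 2n`, the correspondence action (`corrAction`, complex
orientations) of `γ = pr_W^* x ∪ pr_X^* y` is `γ_*(c) = pr_{W*}(pr_X^* c ∪ γ) = (−1)^{a i} x ∪ pr_{W*} pr_X^*(c ∪ y)`
(Hatcher 3.10–3.11 and the projection formula, Fulton App. B (6), the tree's `complexGysin_cup`; part XIV-a's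
`corrClassAction_cross` is the case `a i` even). [cite: VoisinHodgeII2003, proof of Thm. 10.17 (10.7)]
[cite: FultonYoungTableaux1997, Appendix B §B.1 (3), (6)] [cite: HatcherAT2002, §3.2 Prop. 3.10 and Thm. 3.11] -/
theorem corrAction_cross_signed (hW : IsSmoothProjective m W) (hX : IsSmoothProjective n X)
    {i k e a : ℕ} (hik : i + k = 2 * e) (hab : a + 2 * e = i + 2 * n) (hak : a + k = 2 * n)
    (x : complexBetti W i) (y : complexBetti X k) (c : complexBetti X a) :
    corrAction complexOrientationFamily hW hX hab
        (cupProduct hik (complexBetti.map (fst W X) i x) (complexBetti.map (snd W X) k y)) c =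
      ((-1 : ℂ) ^ (a * i)) • cupProduct (Nat.add_zero i) x
        (complexGysin complexOrientationFamily (hW.tensor_holds hX) hW (fst W X)
          (show 2 * n + 2 * m = 0 + 2 * (m + n) by omega)
          (complexBetti.map (snd W X) (2 * n) (cupProduct hak c y))) := by
  rw [corrAction_apply]
  -- `pr_X^* c ∪ (pr_W^* x ∪ pr_X^* y) = (pr_X^* c ∪ pr_W^* x) ∪ pr_X^* y`
  rw [← cupProduct_assoc (show a + i = a + i from rfl) hik (show a + i + k = a + 2 * e by omega) rfl]
  -- `pr_X^* c ∪ pr_W^* x = (-1)^{a i} pr_W^* x ∪ pr_X^* c`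
  rw [cupProduct_gradedComm_holds ℂ _ (show a + i = a + i from rfl) (show i + a = a + i by omega)
    (complexBetti.map (snd W X) a c) (complexBetti.map (fst W X) i x), LinearMap.map_smul₂, map_smul]
  congr 1
  -- `(pr_W^* x ∪ pr_X^* c) ∪ pr_X^* y = pr_W^* x ∪ pr_X^*(c ∪ y)`
  rw [cupProduct_assoc (show i + a = a + i by omega) hak (show a + i + k = a + 2 * e by omega)
    (show i + 2 * n = a + 2 * e by omega), ← complexBetti.map_cupProduct]
  -- projection formula for `pr_W`
  rw [complexGysin_cup hasPoincareDuality_complexOrientationFamily (hW.tensor_holds hX) hW (fst W X)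
    (show i + 2 * n = a + 2 * e by omega) _ (show 2 * n + 2 * m = 0 + 2 * (m + n) by omega) (Nat.add_zero i)]

/-- **One functional computes all cross-product correspondences.** For `W`, `X` smooth projective of dimensions
`m`, `n` there is a linear functional `τ : H²ⁿ(X(ℂ); ℂ) → ℂ`, `τ(z) = ε(pr_{W*} pr_X^* z)`, with (a) `τ z = 0 ⟹ z = 0`
(Künneth in the top degree, the tree's `complexGysin_fst_map_snd_ne_zero_of_ne_zero`) and (b) for ALL `x ∈ Hⁱ(W(ℂ))`,
`y ∈ Hᵏ(X(ℂ))`, `a + k = 2n`: `(pr_W^* x ∪ pr_X^* y)_*(c) = ((−1)^{a i} τ(c ∪ y)) • x` (`H⁰(W(ℂ)) = ℂ · 1`).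
[cite: VoisinHodgeII2003, proof of Thm. 10.17 (10.7)] [cite: HatcherAT2002, §3.2 Thm. 3.15 and §3.1 p. 199] -/
theorem exists_crossFunctional (hW : IsSmoothProjective m W) (hX : IsSmoothProjective n X) :
    ∃ τ : complexBetti X (2 * n) →ₗ[ℂ] ℂ, (∀ z, τ z = 0 → z = 0) ∧
      ∀ ⦃i k e a : ℕ⦄ (hik : i + k = 2 * e) (hab : a + 2 * e = i + 2 * n) (hak : a + k = 2 * n)
        (x : complexBetti W i) (y : complexBetti X k) (c : complexBetti X a),
        corrAction complexOrientationFamily hW hX hab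
            (cupProduct hik (complexBetti.map (fst W X) i x) (complexBetti.map (snd W X) k y)) c =
          ((-1 : ℂ) ^ (a * i) * τ (cupProduct hak c y)) • x := by
  haveI := pathConnectedSpace_complexPoints hW
  have hWX : IsSmoothProjective (m + n) (W ⊗ X) := hW.tensor_holds hX
  let τ : complexBetti X (2 * n) →ₗ[ℂ] ℂ :=
    (singularCohomologyZeroEquiv ℂ ℂ (ComplexPoints W)).toLinearMap ∘ₗ
      (complexGysin complexOrientationFamily hWX hW (fst W X)
        (show 2 * n + 2 * m = 0 + 2 * (m + n) by omega)) ∘ₗ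
        (complexBetti.map (snd W X) (2 * n)).hom
  have hτ : ∀ z, τ z = singularCohomologyZeroEquiv ℂ ℂ (ComplexPoints W)
      (complexGysin complexOrientationFamily hWX hW (fst W X) (show 2 * n + 2 * m = 0 + 2 * (m + n) by omega)
        (complexBetti.map (snd W X) (2 * n) z)) := fun _ ↦ rfl
  refine ⟨τ, fun z hz ↦ ?_, fun i k e a hik hab hak x y c ↦ ?_⟩
  · by_contra hz0
    refine complexGysin_fst_map_snd_ne_zero_of_ne_zero complexOrientationFamily hW hX hz0 ?_
    rw [Literature.AlgebraicTopology.SingularHomology.singularCohomology.eq_smul_one ℂ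
      (complexGysin complexOrientationFamily (hW.tensor_holds hX) hW (fst W X) _
        (complexBetti.map (snd W X) (2 * n) z)), ← hτ, hz, zero_smul]
  · rw [corrAction_cross_signed hW hX hik hab hak x y c, cupProduct_degZero_right, ← hτ, smul_smul]

/-! ## §2 The functional on the rational top line -/

/-- **`τ(w ⊗ 1) = κ · tr(w)` on the rational top line.** For `X` smooth projective of dimension `n` and any
`ℂ`-linear functional `τ` on `H²ⁿ(X(ℂ); ℂ)` there is `κ ∈ ℂ` with `τ(w ⊗ 1) = κ · tr(w)` for every rational top class
`w`, `tr` the (light) trace of the Betti universe — `H²ⁿ(X(ℂ); ℚ)` is a line on which `tr` is injective.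
[cite: HatcherAT2002, §3.3 Thm. 3.26] [cite: VoisinHodgeI2002, §5.3.2 Thm. 5.30] -/
theorem exists_eq_mul_tr (hX : IsSmoothProjective n X) (τ : complexBetti X (2 * n) →ₗ[ℂ] ℂ) :
    ∃ κ : ℂ, ∀ w : bettiCohomology X (2 * n),
      τ (ofRatClass (ComplexPoints X) (2 * n) w) = κ * (BettiUniverse.tr hX (2 * n) w : ℂ) := by
  haveI : FiniteDimensional ℚ (bettiCohomology X (2 * n)) := finiteDimensional_bettiCohomology hX (2 * n)
  have h1 : Module.finrank ℚ (bettiCohomology X (2 * n)) = 1 := finrank_rat_top hX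
  have hinj := tr_top_injective hX
  -- `tr` is bijective onto `ℚ`
  have hsurj : Function.Surjective (BettiUniverse.tr hX (2 * n)) :=
    (LinearMap.injective_iff_surjective_of_finrank_eq_finrank (by rw [h1, Module.finrank_self])).1 hinj
  obtain ⟨w₀, hw₀⟩ := hsurj 1
  refine ⟨τ (ofRatClass (ComplexPoints X) (2 * n) w₀), fun w ↦ ?_⟩
  have hw : w = (BettiUniverse.tr hX (2 * n) w) • w₀ := hinj (by rw [map_smul, hw₀, smul_eq_mul, mul_one])
  conv_lhs => rw [hw, ofRatClass_smul, map_smul]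
  rw [smul_eq_mul, mul_comm]

/-! ## §3 Swapping the factors of a sum of cross products keeps it algebraic -/

/-- **Swap of factors.** For `X` smooth projective and finite families `x_c, y_c ∈ Hⁱ(X(ℂ); ℂ)`: if
`Σ_c pr₁^* x_c ∪ pr₂^* y_c` is an algebraic class of codimension `i` on `X × X`, so is `Σ_c pr₁^* y_c ∪ pr₂^* x_c` —
the pull-back of the former along the swap `X × X ≅ X × X` is `(−1)^{i·i}` times the latter (pull-backs along
morphisms of smooth projective varieties preserve algebraic classes, Fulton Cor. 19.2 (b), the tree's
`fulton1998_map_mem_algebraicClasses_holds`; graded commutativity, Hatcher 3.11).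
[cite: Fulton1998, §19.2 Cor. 19.2 (b)] [cite: HatcherAT2002, §3.2 Thm. 3.11] -/
theorem sum_cross_swap_mem_algebraicClasses (hX : IsSmoothProjective n X) {ι : Type*} (s : Finset ι) {i : ℕ}
    (hi : i + i = 2 * i) (x y : ι → complexBetti X i)
    (h : ∑ c ∈ s, cupProduct hi (complexBetti.map (fst X X) i (x c)) (complexBetti.map (snd X X) i (y c)) ∈
      algebraicClasses (X ⊗ X) i) :
    ∑ c ∈ s, cupProduct hi (complexBetti.map (fst X X) i (y c)) (complexBetti.map (snd X X) i (x c)) ∈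
      algebraicClasses (X ⊗ X) i := by
  have hXX : IsSmoothProjective (n + n) (X ⊗ X) := hX.tensor_holds hX
  set β : X ⊗ X ⟶ X ⊗ X := (β_ X X).hom with hβ
  have hpull := Summit.HodgeConjecture.HodgeConjecture.Theorems.fulton1998_map_mem_algebraicClasses_holds β hXX hXX i _ h
  have hcomp : complexBetti.map β (2 * i)
      (∑ c ∈ s, cupProduct hi (complexBetti.map (fst X X) i (x c)) (complexBetti.map (snd X X) i (y c))) =
      ((-1 : ℂ) ^ (i * i)) •
        ∑ c ∈ s, cupProduct hi (complexBetti.map (fst X X) i (y c)) (complexBetti.map (snd X X) i (x c)) := by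
    rw [map_sum, Finset.smul_sum]
    refine Finset.sum_congr rfl fun c _ ↦ ?_
    rw [complexBetti.map_cupProduct, ← complexBetti.map_comp_apply', ← complexBetti.map_comp_apply', hβ,
      braiding_hom_fst, braiding_hom_snd,
      cupProduct_gradedComm_holds ℂ _ hi hi (complexBetti.map (snd X X) i (x c)) (complexBetti.map (fst X X) i (y c))]
  rw [hcomp] at hpull
  have hunit : ((-1 : ℂ) ^ (i * i)) ≠ 0 := pow_ne_zero _ (neg_ne_zero.2 one_ne_zero)
  have := Submodule.smul_mem _ (((-1 : ℂ) ^ (i * i))⁻¹) hpull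
  rwa [smul_smul, inv_mul_cancel₀ hunit, one_smul] at this

/-! ## §4 `θ^g ≠ 0` for a polarisation class `η = θ ⊗ 1` -/

/-- **The top power of a polarisation class does not vanish, rational form.** For `X` smooth projective of
dimension `g` and a rational `θ ∈ H²(X(ℂ); ℚ)` whose complexification `η = θ ⊗ 1` has the hard Lefschetz property
in dimension `g`, `θ^g ≠ 0` in `H^{2g}(X(ℂ); ℚ)`: `L^g : H⁰ → H^{2g}` is injective and `L^g 1 = η^g = θ^g ⊗ 1`.
[cite: VoisinHodgeI2002, Thm. 6.25] [cite: HatcherAT2002, §3.2 p. 211] -/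
theorem cupPow_ne_zero_of_hasHardLefschetz {g : ℕ} (hX : IsSmoothProjective g X) (θ : bettiCohomology X 2)
    (hL : Literature.Geometry.Kaehler.HasHardLefschetzProperty (ofRatClass (ComplexPoints X) 2 θ) g) :
    cupPow ℚ θ g ≠ 0 := by
  haveI := pathConnectedSpace_complexPoints hX
  intro h0
  have hbij := bijective_lefschetzPowTo_of_hasHardLefschetz (ofRatClass (ComplexPoints X) 2 θ) hL
    (show 0 + g = g by omega) (2 * g) (by omega)
  have h1 : lefschetzPowTo (ofRatClass (ComplexPoints X) 2 θ) g 0 (2 * g) (by omega)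
      (singularCohomology.one ℂ (ComplexPoints X)) = 0 := by
    rw [lefschetzPowTo_one_eq_cupPow, cupPow_complex_eq_cupPowTwo, ← ofRatClass_cupPow, h0, map_zero]
  have h2 : singularCohomology.one ℂ (ComplexPoints X) = 0 := hbij.1 (by rw [h1, map_zero])
  have h3 := Literature.AlgebraicTopology.SingularHomology.singularCohomologyZeroEquiv_one (X := ComplexPoints X) ℂ
  rw [h2, map_zero] at h3
  exact zero_ne_one h3

/-! ## §5 The bijective algebraic Fourier correspondence -/

/-- Surjective linear maps between complex vector spaces of equal finite dimension are bijective (bookkeeping).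
[folklore] -/
theorem bijective_of_surjective_of_finrank_eq {V V' : Type*} [AddCommGroup V] [Module ℂ V] [AddCommGroup V']
    [Module ℂ V'] [FiniteDimensional ℂ V] [FiniteDimensional ℂ V'] (h : Module.finrank ℂ V = Module.finrank ℂ V')
    (T : V →ₗ[ℂ] V') (hT : Function.Surjective T) : Function.Bijective T :=
  ⟨(LinearMap.injective_iff_surjective_of_finrank_eq_finrank h).2 hT, hT⟩

/-- A `ℂ`-linear map out of `Hʲ(X(ℂ); ℂ)` whose composite with `· ⊗ 1` is a non-zero multiple of `(· ⊗ 1) ∘ D` for a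
SURJECTIVE rational `D` is surjective: rational classes span (`span_isRationalClass_eq_top_of_isSmoothProjective_holds`).
[cite: VoisinHodgeI2002, §7.1.1] -/
theorem surjective_of_comp_ofRatClass (hX : IsSmoothProjective n X) {j i : ℕ} {V : Type*} [AddCommGroup V]
    [Module ℂ V] (T : V →ₗ[ℂ] complexBetti X i) (D : bettiCohomology X j → bettiCohomology X i)
    (hD : Function.Surjective D) (S : bettiCohomology X j → V) (κ : ℂ) (hκ : κ ≠ 0)
    (hT : ∀ z, T (S z) = κ • ofRatClass (ComplexPoints X) i (D z)) : Function.Surjective T := by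
  rw [← LinearMap.range_eq_top, eq_top_iff, ← span_isRationalClass_eq_top_of_isSmoothProjective_holds n X hX i,
    Submodule.span_le]
  intro c hc
  obtain ⟨w, rfl⟩ := (isRationalClass_iff_mem_range_ofRatClass c).1 hc
  obtain ⟨z, rfl⟩ := hD w
  refine ⟨κ⁻¹ • S z, ?_⟩
  rw [map_smul, hT, smul_smul, inv_mul_cancel₀ hκ, one_smul]

/-- **THE FOURIER CORRESPONDENCE OF A POLARISED ABELIAN VARIETY IS ALGEBRAIC AND BIJECTIVE.** For a complex
abelian variety `A` of dimension `g ≥ 1`, a polarisation class `η` of `A` and degrees `j + i = 2g`, there is an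
algebraic class `γ ∈ Nⁱ H^{2i}((A × A)(ℂ); ℂ)` whose correspondence action
`γ_* = pr_{1*}(pr_2^*(·) ∪ γ) : Hʲ(A(ℂ); ℂ) → Hⁱ(A(ℂ); ℂ)` (complex orientations) is BIJECTIVE — Kleiman 2A8–2A10:
`γ = ± ℓ^i = Σ_c pr₁^* m_i(y ∘ c) ∪ pr₂^* m_i(b ∘ c)` for a basis `b` of `H¹` and its polar basis `y`
(`ℓ = m^*θ − pr₁^*θ − pr₂^*θ`, `η = θ ⊗ 1`), acting by `z ⊗ 1 ↦ ± κ · (Σ_c tr(z ∪ m_i(b∘c)) m_i(y∘c)) ⊗ 1`, a non-zero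
multiple of the complexified Fourier sum, which is bijective (COR-CM `bijective_of_eq_fourierSum_tr`); so `γ_*` is
surjective (rational classes span `Hⁱ(A(ℂ); ℂ)`) and bijective (`b_j(A) = (2g choose j) = (2g choose i) = b_i(A)`).
[cite: Kleiman1968AlgebraicCycles, Appendix to §2, 2A8–2A11] [cite: Lieberman1968, pp. 366–374]
[cite: MumfordAV1970, §1 (4), §16 and §20] -/
theorem exists_bijective_corrAction (A : AbelianVariety ℂ) (hg : 1 ≤ A.dim) {η : complexBetti A.X 2}
    (hη : IsPolarizationClass A.dim A.X η) {i j : ℕ} (hij : j + i = 2 * A.dim) :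
    ∃ γ ∈ algebraicClasses (A.X ⊗ A.X) i, Function.Bijective
      (corrAction complexOrientationFamily (AbelianVariety.isSmoothProjective_holds (A := A))
        (AbelianVariety.isSmoothProjective_holds (A := A)) (show j + 2 * i = i + 2 * A.dim by omega) γ) := by
  classical
  have hA : IsSmoothProjective A.dim A.X := AbelianVariety.isSmoothProjective_holds (A := A)
  set g := A.dim with hgdef
  -- `η = θ ⊗ 1`, `θ` rational algebraic with `θ^g ≠ 0`
  obtain ⟨θ, hθ⟩ := (isRationalClass_iff_mem_range_ofRatClass η).1 hη.isRationalClass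
  have hθalg : θ ∈ ratAlgebraicClasses A.X 1 := by
    rw [mem_ratAlgebraicClasses_iff]
    change ofRatClass (ComplexPoints A.X) 2 θ ∈ algebraicClasses A.X 1
    rw [hθ]
    exact hη.mem_algebraicClasses
  have hθtop : cupPow ℚ θ g ≠ 0 := cupPow_ne_zero_of_hasHardLefschetz hA θ (by rw [hθ]; exact hη.hasHardLefschetz)
  -- a basis `b` of `H¹(A(ℂ); ℚ)` and its polar basis `y`
  haveI : FiniteDimensional ℚ (bettiCohomology A.X 1) := finiteDimensional_bettiCohomology hA 1
  let b : Module.Basis (Fin (Module.finrank ℚ (bettiCohomology A.X 1))) ℚ (bettiCohomology A.X 1) :=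
    Module.finBasis ℚ _
  set N := Module.finrank ℚ (bettiCohomology A.X 1) with hN
  obtain ⟨y₀, hℓ⟩ := exists_polClass_eq_sum A b θ
  have hk : g - 1 + 1 = g := Nat.sub_add_cancel hg
  have hθ' : cupPow ℚ θ (g - 1 + 1) ≠ 0 := by rwa [hk]
  have hLI : LinearIndependent ℚ y₀ := polarFamily_linearIndependent A hk b hθ' hℓ
  have hsp : ⊤ ≤ Submodule.span ℚ (Set.range y₀) := (polarFamily_span_eq_top A hk b hθ' hℓ).ge
  let y : Module.Basis (Fin N) ℚ (bettiCohomology A.X 1) := Module.Basis.mk hLI hsp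
  have hy : (y : Fin N → bettiCohomology A.X 1) = y₀ := Module.Basis.coe_mk hLI hsp
  -- the rational Fourier kernel is algebraic (`± ℓ(θ)^i`)
  have halg := sum_pull_cupPowOne_cup_mem_ratAlgebraicClasses A hθalg b y₀ hℓ i
  rw [mem_ratAlgebraicClasses_iff, map_sum] at halg
  simp only [ofRatClass_cupProduct, ofRatClass_pull, ofRatClass_cupPowOne] at halg
  -- the complex kernels
  set P : (Fin i → Fin N) → complexBetti A.X i := fun c ↦
    cupPowOne ℂ (ComplexPoints A.X) i (fun k ↦ ofRatClass (ComplexPoints A.X) 1 (b (c k))) with hP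
  set Q : (Fin i → Fin N) → complexBetti A.X i := fun c ↦
    cupPowOne ℂ (ComplexPoints A.X) i (fun k ↦ ofRatClass (ComplexPoints A.X) 1 (y₀ (c k))) with hQ
  have halg' : ∑ c, cupProduct (two_mul i).symm (complexBetti.map (fst A.X A.X) i (P c))
      (complexBetti.map (snd A.X A.X) i (Q c)) ∈ algebraicClasses (A.X ⊗ A.X) i := halg
  -- the SWAPPED kernel `γ = Σ_c pr₁^* Q_c ∪ pr₂^* P_c`
  have hγ := sum_cross_swap_mem_algebraicClasses hA Finset.univ (two_mul i).symm P Q halg'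
  refine ⟨_, hγ, ?_⟩
  -- the functional `τ` and its rational comparison
  obtain ⟨τ, hτ0, hτ⟩ := exists_crossFunctional hA hA
  obtain ⟨κ, hκ⟩ := exists_eq_mul_tr hA τ
  -- the rational Fourier sum `F z = Σ_c tr(z ∪ m_i(b∘c)) • m_i(y∘c)`, bijective
  let F := fourierSum hA (b : Fin N → bettiCohomology A.X 1) y₀ i hij
  have hFbij : Function.Bijective F :=
    bijective_of_eq_fourierSum_tr A hA b y hij F (fun z ↦ by rw [hy]; exact fourierSum_apply hA _ _ i hij z)
  -- `γ_*(z ⊗ 1) = ((-1)^{j i} κ) • (F z) ⊗ 1`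
  have hT : ∀ z : bettiCohomology A.X j,
      corrAction complexOrientationFamily hA hA (show j + 2 * i = i + 2 * A.dim by omega)
        (∑ c, cupProduct (two_mul i).symm (complexBetti.map (fst A.X A.X) i (Q c))
          (complexBetti.map (snd A.X A.X) i (P c)))
        (ofRatClass (ComplexPoints A.X) j z) =
      ((-1 : ℂ) ^ (j * i) * κ) • ofRatClass (ComplexPoints A.X) i (F z) := by
    intro z
    rw [map_sum, LinearMap.sum_apply, fourierSum_apply, map_sum, Finset.smul_sum]
    refine Finset.sum_congr rfl fun c _ ↦ ?_
    rw [hτ (two_mul i).symm (show j + 2 * i = i + 2 * A.dim by omega) hij (Q c) (P c), hP, hQ]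
    dsimp only
    rw [← ofRatClass_cupPowOne, ← ofRatClass_cupPowOne,
      ← ofRatClass_cupProduct, hκ, ofRatClass_smul, smul_smul, mul_assoc]
    rfl
  -- non-vanishing of `κ`
  have hκ0 : κ ≠ 0 := by
    intro hκ0
    -- `τ` vanishes on all rational top classes, hence on a spanning set: contradiction with (a)
    have hzero : ∀ w : bettiCohomology A.X (2 * g), ofRatClass (ComplexPoints A.X) (2 * g) w = 0 := fun w ↦
      hτ0 _ (by rw [hκ w, hκ0, zero_mul])
    haveI : FiniteDimensional ℚ (bettiCohomology A.X (2 * g)) := finiteDimensional_bettiCohomology hA (2 * g)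
    have h1 : Module.finrank ℚ (bettiCohomology A.X (2 * g)) = 1 := finrank_rat_top hA
    obtain ⟨w, hw⟩ := (Module.finrank_pos_iff_exists_ne_zero (R := ℚ) (M := bettiCohomology A.X (2 * g))).1
      (by omega)
    exact hw (ofRatClass_injective (Y := ComplexPoints A.X) (2 * g) (by rw [hzero w, map_zero]))
  have hunit : ((-1 : ℂ) ^ (j * i) * κ) ≠ 0 := mul_ne_zero (pow_ne_zero _ (neg_ne_zero.2 one_ne_zero)) hκ0
  -- surjective, hence bijective
  haveI := finite_complexBetti_abelianVariety A j
  haveI := finite_complexBetti_abelianVariety A i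
  refine bijective_of_surjective_of_finrank_eq ?_ _
    (surjective_of_comp_ofRatClass hA _ F hFbij.2 (ofRatClass (ComplexPoints A.X) j) _ hunit hT)
  rw [abelianVarietyCohomologyExteriorH1_holds.finrank_eq A j, abelianVarietyCohomologyExteriorH1_holds.finrank_eq A i]
  exact Nat.choose_symm_of_eq_add (by omega)

/-- **The same in the `IsAlgebraicCorrespondence` vocabulary of the André axis**: for `A` of dimension `g ≥ 1`, a
polarisation class, and `j + i = 2g`, there is a BIJECTIVE `ℂ`-linear map `Hʲ(A(ℂ); ℂ) → Hⁱ(A(ℂ); ℂ)` induced by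
an algebraic correspondence (`IsAlgebraicCorrespondence g g A A`). [cite: Kleiman1968AlgebraicCycles, Appendix to §2, 2A8–2A11]
[cite: Lieberman1968, pp. 366–374] -/
theorem exists_bijective_algebraicCorrespondence (A : AbelianVariety ℂ) (hg : 1 ≤ A.dim)
    {η : complexBetti A.X 2} (hη : IsPolarizationClass A.dim A.X η) {i j : ℕ} (hij : j + i = 2 * A.dim) :
    ∃ T : complexBetti A.X j →ₗ[ℂ] complexBetti A.X i,
      IsAlgebraicCorrespondence A.dim A.dim A.X A.X T ∧ Function.Bijective T := by
  have hA : IsSmoothProjective A.dim A.X := AbelianVariety.isSmoothProjective_holds (A := A)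
  obtain ⟨γ, hγ, hbij⟩ := exists_bijective_corrAction A hg hη hij
  exact ⟨_, isAlgebraicCorrespondence_corrAction complexOrientationFamily hasPoincareDuality_complexOrientationFamily hA hA
    (show j + 2 * i = i + 2 * A.dim by omega) (show i + (2 * A.dim - i) = 2 * A.dim by omega) hγ, hbij⟩

end Summit.HodgeConjecture.HodgeConjecture.Ring2.AbelianAll

end
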